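import Mathlib
import HarnessLib
import Literature.Combinatorics.Additive.Pollard
import Literature.Combinatorics.Additive.Kneser
import Literature.Combinatorics.Additive.GrynkiewiczPollardRep
import Literature.Combinatorics.Additive.GrynkiewiczPollardKneserTools
import Literature.Combinatorics.Additive.GrynkiewiczPollardStepOne
import Literature.Combinatorics.Additive.PollardFourThirds

/-!
# Pollard's inequality relative to the largest coset inside `A + B` (Hamidoune–Serra 2008, Theorem 1)

Topic: `Literature/Combinatorics/Additive`.  Y. O. Hamidoune, O. Serra, *A note on Pollard's Theorem*,
arXiv:0804.2593 (2008) (held `paper:arxiv-0804.2593`, chunks p0001–p0007, read 2026-08-28), **Theorem 1**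
(printed multiplicatively; `N_i(A,B) = {x ∈ AB : r_{A,B}(x) ≥ i}`, `α(A,B)` = the largest cardinality of a
coset — of any subgroup, the trivial one included — contained in `AB`):

«Let `t` be an integer and `A, B` be finite subsets of an abelian group `G` with `1 ∈ A ∩ B` and
`|A| ≥ |B| ≥ t ≥ 1`.  Set `α = α(A,B)` and `w = min(α − 1, 1)`.  Then
`Σ_{1 ≤ i ≤ t} |N_i(A,B)| ≥ t(|A| + |B| − t − α + 1 + w) − w`.                                    (1)
Moreover the inequality (1) is strict in the following cases: (I) `α ≥ 3` and `t ≥ 2`, (II) `α ≥ 2` and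
`t = 2`.»

For `α = 1` (no coset of a non-trivial subgroup inside `A + B`) this is Pollard's inequality
`Σ ≥ t(|A| + |B| − t)` in an arbitrary abelian group («a local Green–Ruzsa type theorem»).

Rendering (additive notation; `Σ_{i ≤ t} |N_i(A,B)| = Σ_{x ∈ A+B} min(t, r_{A,B}(x)) = Grynkiewicz.NS t A B`):
* the parameter `α` enters as an UPPER BOUND: hypothesis
  `∀ (K : AddSubgroup G) (g : G), (∀ k ∈ K, g + k ∈ A + B) → Nat.card K ≤ α` («every coset contained in
  `A + B` has at most `α` elements»).  Since the right side of (1) is non-increasing in `α` (it equals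
  `t(|A|+|B|−t)` at `α = 1` and drops by `1`, then by `t` per unit of `α`), and the strictness clauses are
  upward-closed in `α`, the statements for every admissible upper bound `α` and for the printed
  `α = α(A,B)` are equivalent;
* the normalisations `1 ∈ A ∩ B` and `|A| ≥ |B|` of the print are without loss of generality (both sides
  of (1) are invariant under translating `A` or `B` and symmetric in `A, B`); they are dropped from the
  statements and performed inside the proof;
* (1) is stated free of truncated subtraction as `t(|A|+|B|+1+w) ≤ NS + w + t(t+α)` (equivalent to the
  printed form for every sign of `|A|+|B|−t−α+1+w`; the printed shape is `hamidouneSerra2008_thm_1_sub`),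
  strictness as `t(|A|+|B|+2) ≤ NS + t(t+α)`.

Proof: the printed induction on `|B|` (§3): `|B| = t` by `Σ_{i ≤ |B|} |N_i| = |A||B|` (Lemma 3 (ii), tree
`NS_eq_card_mul_card`); the case `AB = A·b₀` (then `B b₀⁻¹` lies in the period of `A`, a coset of which lies
in `AB`, so `α ≥ |B| ≥ t + 1`, and `Σ ≥ t|A|`); otherwise a translate `A′ ∋ b₀` of `A` with `B ⊄ A′`,
`v = |A′ ∩ B|`, Pollard's splitting (Lemma 3 (iii), `NS_union_inter_add_NS_sdiff_le`, from the tree's Dyson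
decomposition `Pollard.rep_eq_rep_union_inter_add`) with `u = t` if `t ≤ v` (induction for
`(A′ ∪ B, A′ ∩ B)`) and `u = v` if `v < t` (Lemma 3 (ii) for the first summand, induction for
`(A′ ∖ B, B ∖ A′)`), Lemma 4 (iii) being the transfer of the coset bound to sub-sumsets of a translate
(`bound_mono`); the slack `v(α − 1 − w)` gives strictness in case (I).  DEVIATION: strictness in case (II)
(`t = 2`) is taken from the tree's kernel form of Grynkiewicz's `t = 2` theorem
(`GrynkiewiczWang.goal_all` at `t = 2` with `GrynkiewiczWang.printed_of_str`: `|N₁| + |N₂| ≥ 2|A| + 2|B| − 2|H|`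
with `H` the period of `N₂(A,B) ⊆ A + B`, so `|H| ≤ α`), exactly as the source remarks («For `t = 2`
Theorem 1 follows from the result of Grynkiewicz mentioned above»); the printed Kneser /
Kemperman–Scherk argument for `t = α = 2`, `v = 1` is therefore not replayed.

## References
* Y. O. Hamidoune, O. Serra, *A note on Pollard's Theorem*, arXiv:0804.2593 (2008), Theorem 1, Lemmas 3–4
  [cite: HamidouneSerra2008, Thm 1].
* D. J. Grynkiewicz, Israel J. Math. 177 (2010) 413–439, Thm 1.2 [cite: Grynkiewicz2010, Thm 1.2];
  D. J. Grynkiewicz, R. Wang, arXiv:2601.17922, Thm 1.8 [cite: GrynkiewiczWang2026, Thm 1.8].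
* J. M. Pollard, J. London Math. Soc. (2) 8 (1974) 460–462 [cite: Pollard1974, Thm 1].
-/

namespace Literature.Combinatorics.Additive

namespace HamidouneSerra

open Finset Pollard Grynkiewicz
open scoped Pointwise

variable {G : Type*} [AddCommGroup G] [DecidableEq G]

/-! ### Tools -/

/-- Translating `A` does not change `N_t`. [cite: HamidouneSerra2008, Lemma 3 (i)] -/
theorem NS_vadd_left (t : ℕ) (A B : Finset G) (x : G) : NS t (x +ᵥ A) B = NS t A B := by
  rw [NS_comm, NS_vadd_right, NS_comm]

/-- `(x + A) + B = x + (A + B)`. [cite: HamidouneSerra2008, Lemma 4 (i)] -/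
theorem vadd_finset_add (A B : Finset G) (x : G) : (x +ᵥ A) + B = x +ᵥ (A + B) := by
  rw [add_comm, add_vadd_finset, add_comm]

/-- **Pollard's splitting** (Lemma 3 (iii) of the source): for `u ≤ t`,
`Σ_{i ≤ u} |N_i(A ∩ B, A ∪ B)| + Σ_{i ≤ t−u} |N_i(A ∖ B, B ∖ A)| ≤ Σ_{i ≤ t} |N_i(A,B)|`, from the Dyson
decomposition `r_{A,B} = r_{A∪B,A∩B} + r_{A∖B,B∖A}`. [cite: HamidouneSerra2008, Lemma 3 (iii)] -/
theorem NS_union_inter_add_NS_sdiff_le {u t : ℕ} (hu : u ≤ t) (A B : Finset G) :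
    NS u (A ∪ B) (A ∩ B) + NS (t - u) (A \ B) (B \ A) ≤ NS t A B := by
  rw [NS_eq_sum_of_subset u (union_add_inter_subset A B),
    NS_eq_sum_of_subset (t - u) (add_subset_add sdiff_subset sdiff_subset : A \ B + B \ A ⊆ A + B),
    NS_def, ← sum_add_distrib]
  refine sum_le_sum fun x _ => ?_
  rw [rep_eq_rep_union_inter_add A B x]
  omega

/-- The period of a nonempty finset as a subgroup: its cardinality. [cite: HamidouneSerra2008, §1] -/
theorem natCard_stabilizer {S : Finset G} (hS : S.Nonempty) :
    Nat.card (AddAction.stabilizer G (S : Set G)) = S.addStab.card := by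
  have hcoe : (S.addStab : Set G) = (AddAction.stabilizer G (S : Set G) : Set G) := by
    simpa using coe_addStab hS
  have e : Nat.card (AddAction.stabilizer G (S : Set G)) = Nat.card (S.addStab : Set G) := by
    rw [hcoe]; rfl
  rw [e, Nat.card_coe_set_eq, Set.ncard_coe_finset]

/-- Membership in the period subgroup is membership in `Finset.addStab`. [cite: HamidouneSerra2008, §1] -/
theorem mem_stabilizer_iff {S : Finset G} (hS : S.Nonempty) {k : G} :
    k ∈ AddAction.stabilizer G (S : Set G) ↔ k ∈ S.addStab := by
  have hcoe : (S.addStab : Set G) = (AddAction.stabilizer G (S : Set G) : Set G) := by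
    simpa using coe_addStab hS
  rw [← SetLike.mem_coe, ← hcoe, mem_coe]

/-- If a coset `g + H(S)` of the period of `S` lies in `A + B`, the coset bound gives `|H(S)| ≤ α`.
[cite: HamidouneSerra2008, Thm 1 (proof)] -/
theorem card_addStab_le_of_bound {α : ℕ} {A B : Finset G}
    (hα : ∀ (K : AddSubgroup G) (g : G), (∀ k ∈ K, g + k ∈ A + B) → Nat.card K ≤ α)
    {S : Finset G} (hS : S.Nonempty) {g : G} (hg : ∀ h ∈ S.addStab, g + h ∈ A + B) :
    S.addStab.card ≤ α := by
  rw [← natCard_stabilizer hS]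
  exact hα _ g fun k hk => hg k ((mem_stabilizer_iff hS).1 hk)

/-- Singletons are cosets of the trivial subgroup: `α ≥ 1` as soon as `A, B ≠ ∅`.
[cite: HamidouneSerra2008, Thm 1 (proof)] -/
theorem one_le_of_bound {α : ℕ} {A B : Finset G}
    (hα : ∀ (K : AddSubgroup G) (g : G), (∀ k ∈ K, g + k ∈ A + B) → Nat.card K ≤ α)
    (hA : A.Nonempty) (hB : B.Nonempty) : 1 ≤ α := by
  obtain ⟨x, hx⟩ := hA.add hB
  have := hα ⊥ x (fun k hk => by rw [AddSubgroup.mem_bot] at hk; rw [hk, add_zero]; exact hx)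
  rwa [AddSubgroup.card_bot] at this

/-- **Lemma 4 (iii)** in upper-bound form: the coset bound passes to any pair whose sumset lies in a
translate of `A + B`. [cite: HamidouneSerra2008, Lemma 4 (iii)] -/
theorem bound_mono {α : ℕ} {A B A₁ B₁ : Finset G} {g : G} (h : A₁ + B₁ ⊆ g +ᵥ (A + B))
    (hα : ∀ (K : AddSubgroup G) (x : G), (∀ k ∈ K, x + k ∈ A + B) → Nat.card K ≤ α) :
    ∀ (K : AddSubgroup G) (x : G), (∀ k ∈ K, x + k ∈ A₁ + B₁) → Nat.card K ≤ α := by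
  intro K x hx
  refine hα K (x - g) fun k hk => ?_
  have h1 := h (hx k hk)
  rw [mem_vadd_finset] at h1
  obtain ⟨y, hy, hyx⟩ := h1
  rw [vadd_eq_add] at hyx
  have e : x - g + k = y := by rw [sub_add_eq_add_sub, ← hyx, add_sub_cancel_left]
  rwa [e]

/-! ### Case (II) of strictness: `t = 2`, from Grynkiewicz's `t = 2` theorem -/

/-- For `t = 2`: `|N₁| + |N₂| ≥ 2|A| + 2|B| − 2α` whenever every coset inside `A + B` has at most `α ≥ 2`
elements and `|A|, |B| ≥ 2` — from the kernel `t = 2` case of [cite: GrynkiewiczWang2026, Thm 1.8]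
(= [cite: Grynkiewicz2010, Thm 1.2]): either `|N₁|+|N₂| ≥ 2|A|+2|B|−4`, or `|N₁|+|N₂| ≥ 2|A|+2|B|−2|H|` with
`H` the period of `N₂(A,B) ⊆ A + B`. [cite: HamidouneSerra2008, Thm 1 (II)] -/
theorem two_mul_card_le_NS_two {α : ℕ} (A B : Finset G)
    (hα : ∀ (K : AddSubgroup G) (g : G), (∀ k ∈ K, g + k ∈ A + B) → Nat.card K ≤ α) (hα2 : 2 ≤ α)
    (hA : 2 ≤ A.card) (hB : 2 ≤ B.card) : 2 * (A.card + B.card) ≤ NS 2 A B + 2 * α := by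
  rcases GrynkiewiczWang.goal_all (t := 2) le_rfl A B hA hB with h | ⟨A', B', hS⟩
  · norm_num at h
    omega
  rcases GrynkiewiczWang.printed_of_str (by norm_num : 1 ≤ 2) hA hB hS with h | h
  · omega
  obtain ⟨A'', -, B'', -, -, -, hP, -, hA''2, hB''2, -, h9a, h9b⟩ := h
  set P := (A + B).filter (fun x => 2 ≤ rep A B x) with hPdef
  have hPne : P.Nonempty := by
    rw [← hP]
    exact (card_pos.1 (by omega : 0 < A''.card)).add (card_pos.1 (by omega : 0 < B''.card))
  obtain ⟨p, hp⟩ := hPne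
  have hH : P.addStab.card ≤ α := by
    refine card_addStab_le_of_bound hα ⟨p, hp⟩ (g := p) fun h hh => ?_
    have h1 : h + p ∈ P := by
      have := (mem_addStab' ⟨p, hp⟩).1 hh hp
      rwa [vadd_eq_add] at this
    rw [add_comm p h]
    exact (mem_filter.1 h1).1
  have key : (2 * (A.card + B.card) : ℤ) ≤ NS 2 A B + 2 * α := by
    have hHz : ((P.addStab.card : ℕ) : ℤ) ≤ α := by exact_mod_cast hH
    push_cast at h9a h9b ⊢
    linarith
  exact_mod_cast key

/-! ### Theorem 1: the induction on `|B|` -/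

/-- The inductive core of Theorem 1 (induction on `l = |B|` with `|B| ≤ |A|`): the main inequality (1) in
subtraction-free form together with strictness in case (I). [cite: HamidouneSerra2008, Thm 1] -/
theorem thm1_aux (α : ℕ) :
    ∀ (l : ℕ) (A B : Finset G), B.card = l → l ≤ A.card →
      (∀ (K : AddSubgroup G) (g : G), (∀ k ∈ K, g + k ∈ A + B) → Nat.card K ≤ α) →
      ∀ t : ℕ, t ≤ l →
        t * (A.card + B.card + 1 + min (α - 1) 1) ≤ NS t A B + min (α - 1) 1 + t * (t + α) ∧
        (3 ≤ α → 2 ≤ t → t * (A.card + B.card + 2) ≤ NS t A B + t * (t + α)) := by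
  intro l
  induction l using Nat.strong_induction_on with
  | _ l ih =>
  intro A B hBl hlA hα t htl
  rcases Nat.eq_zero_or_pos t with rfl | ht1
  · simp
  have hBne : B.Nonempty := card_pos.1 (by omega)
  have hAne : A.Nonempty := card_pos.1 (by omega)
  have hα1 : 1 ≤ α := one_le_of_bound hα hAne hBne
  have hw1 : min (α - 1) 1 ≤ 1 := min_le_right _ _
  have hwα : 1 + min (α - 1) 1 ≤ α := by omega
  have hw2 : 2 ≤ α → 1 ≤ min (α - 1) 1 := by omega
  -- the base case `|B| = t` [cite: HamidouneSerra2008, §3 ¶1]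
  by_cases hlt : l ≤ t
  · have hNS : NS t A B = A.card * B.card := NS_eq_card_mul_card A (by omega)
    have hBt : B.card = t := by omega
    rw [hNS, hBt]
    refine ⟨?_, fun hα3 ht2 => ?_⟩
    · nlinarith [Nat.mul_le_mul_left t hwα]
    · nlinarith [Nat.mul_le_mul_left t hα3]
  obtain ⟨b₀, hb₀⟩ := hBne
  by_cases hper : ∀ a ∈ A, ∀ b ∈ B, a + b - b₀ ∈ A
  · -- `A + B = A + b₀`: `B − b₀` lies in the period of `A`, so `α ≥ |H(A)| ≥ |B| ≥ t + 1`
    -- [cite: HamidouneSerra2008, §3 ¶2]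
    have hsub : -b₀ +ᵥ B ⊆ A.addStab := by
      intro y hy
      obtain ⟨b, hb, rfl⟩ := mem_vadd_finset.1 hy
      refine mem_addStab_of_forall_add_mem hAne fun z hz => ?_
      have h1 := hper z hz b hb
      rw [vadd_eq_add, show -b₀ + b + z = z + b - b₀ by abel]
      exact h1
    have hcardB : B.card ≤ A.addStab.card := by
      rw [← card_vadd_finset (-b₀) B]; exact card_le_card hsub
    obtain ⟨a₀, ha₀⟩ := hAne
    have hstab : A.addStab.card ≤ α := by
      refine card_addStab_le_of_bound hα ⟨a₀, ha₀⟩ (g := a₀ + b₀) fun h hh => ?_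
      have h1 : h + a₀ ∈ A := by
        have := (mem_addStab' ⟨a₀, ha₀⟩).1 hh ha₀
        rwa [vadd_eq_add] at this
      rw [show a₀ + b₀ + h = (h + a₀) + b₀ by abel]
      exact add_mem_add h1 hb₀
    have hNS : t * A.card ≤ NS t A B := mul_card_le_NS A (by omega)
    have hαl : B.card ≤ α := le_trans hcardB hstab
    refine ⟨?_, fun hα3 ht2 => ?_⟩
    · rcases Nat.lt_or_ge t 2 with ht2 | ht2
      · obtain rfl : t = 1 := by omega
        omega
      · nlinarith [Nat.mul_le_mul_left t hαl, Nat.mul_le_mul_left t ht2, Nat.mul_le_mul_left t hw1]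
    · nlinarith [Nat.mul_le_mul_left t hαl, Nat.mul_le_mul_left t ht2]
  -- otherwise: a translate `A′ ∋ b₀` of `A` with `B ⊄ A′` [cite: HamidouneSerra2008, §3 ¶3]
  push Not at hper
  obtain ⟨a, ha, b, hb, hab⟩ := hper
  obtain ⟨A', hA'def⟩ : ∃ A' : Finset G, A' = (b₀ - a) +ᵥ A := ⟨_, rfl⟩
  have hb₀A' : b₀ ∈ A' := by
    rw [hA'def]; exact mem_vadd_finset.2 ⟨a, ha, by rw [vadd_eq_add, sub_add_cancel]⟩
  have hbA' : b ∉ A' := by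
    rw [hA'def]
    intro h
    obtain ⟨z, hz, hzb⟩ := mem_vadd_finset.1 h
    rw [vadd_eq_add] at hzb
    have e : z = a + b - b₀ := by rw [← hzb]; abel
    exact hab (e ▸ hz)
  have hcA' : A'.card = A.card := by rw [hA'def]; exact card_vadd_finset _ _
  have hNS' : NS t A B = NS t A' B := by rw [hA'def]; exact (NS_vadd_left t A B (b₀ - a)).symm
  have hα' : ∀ (K : AddSubgroup G) (g : G), (∀ k ∈ K, g + k ∈ A' + B) → Nat.card K ≤ α :=
    bound_mono (g := b₀ - a) (by rw [hA'def, vadd_finset_add]) hα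
  -- Pollard's splitting sets `A′ ∪ B ⊇ A′ ∩ B` and `S = A′ ∖ B`, `T = B ∖ A′`, `v = |A′ ∩ B|`
  have hUI : (A' ∪ B).card + (A' ∩ B).card = A.card + B.card := by
    rw [card_union_add_card_inter, hcA']
  have hSI : (A' \ B).card + (A' ∩ B).card = A.card := by rw [card_sdiff_add_card_inter, hcA']
  have hTI : (B \ A').card + (A' ∩ B).card = B.card := by rw [inter_comm, card_sdiff_add_card_inter]
  have hv1 : 1 ≤ (A' ∩ B).card := card_pos.2 ⟨b₀, mem_inter.2 ⟨hb₀A', hb₀⟩⟩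
  have hvl : (A' ∩ B).card < B.card :=
    card_lt_card ⟨inter_subset_right, fun h => hbA' (mem_inter.1 (h hb)).1⟩
  have hαUI : ∀ (K : AddSubgroup G) (g : G), (∀ k ∈ K, g + k ∈ (A' ∪ B) + (A' ∩ B)) → Nat.card K ≤ α :=
    bound_mono (g := (0 : G)) (by rw [zero_vadd]; exact union_add_inter_subset A' B) hα'
  have hαST : ∀ (K : AddSubgroup G) (g : G), (∀ k ∈ K, g + k ∈ (A' \ B) + (B \ A')) → Nat.card K ≤ α :=
    bound_mono (g := (0 : G)) (by rw [zero_vadd]; exact add_subset_add sdiff_subset sdiff_subset) hα'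
  by_cases htv : t ≤ (A' ∩ B).card
  · -- `t ≤ v`: induction for `(A′ ∪ B, A′ ∩ B)` [cite: HamidouneSerra2008, §3 ¶4]
    obtain ⟨hm, hs⟩ := ih (A' ∩ B).card (by omega) (A' ∪ B) (A' ∩ B) rfl (by omega) hαUI t htv
    have hle : NS t (A' ∪ B) (A' ∩ B) ≤ NS t A' B := NS_union_inter_le t A' B
    refine ⟨?_, fun hα3 ht2 => ?_⟩
    · rw [← hUI, hNS']; linarith [hm, hle]
    · rw [← hUI, hNS']; linarith [hs hα3 ht2, hle]
  -- `v < t`: Lemma 3 (ii) for the first summand, induction for `(S, T)` [cite: HamidouneSerra2008, §3 ¶5]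
  push Not at htv
  obtain ⟨t', rfl⟩ : ∃ t', t = (A' ∩ B).card + t' := ⟨t - (A' ∩ B).card, by omega⟩
  obtain ⟨hm, -⟩ :=
    ih (B \ A').card (by omega) (A' \ B) (B \ A') rfl (by omega) hαST t' (by omega)
  have hNSUI : NS (A' ∩ B).card (A' ∪ B) (A' ∩ B) = (A' ∪ B).card * (A' ∩ B).card :=
    NS_eq_card_mul_card (A' ∪ B) le_rfl
  have hdy := NS_union_inter_add_NS_sdiff_le (Nat.le_add_right (A' ∩ B).card t') A' B
  rw [Nat.add_sub_cancel_left] at hdy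
  have hU : (A' ∪ B).card = (A' \ B).card + (B \ A').card + (A' ∩ B).card := by omega
  rw [hU] at hNSUI
  have hvα := Nat.mul_le_mul_left (A' ∩ B).card hwα
  refine ⟨?_, fun hα3 ht2 => ?_⟩
  · rw [hNS', ← hSI, ← hTI]
    linarith [hm, hdy, hNSUI, hvα]
  · have hw : min (α - 1) 1 = 1 := le_antisymm hw1 (hw2 (by omega))
    rw [hw] at hm
    rw [hNS', ← hSI, ← hTI]
    linarith [hm, hdy, hNSUI, Nat.mul_le_mul_left (A' ∩ B).card hα3]

/-! ### Theorem 1 -/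

/-- **[HamidouneSerra2008, Theorem 1]** — the inequality (1), for finite `A, B` in an arbitrary abelian
group, `t ≤ min(|A|,|B|)`, and any `α` bounding the cardinality of every coset contained in `A + B`:
`t(|A| + |B| + 1 + w) ≤ Σ_{x ∈ A+B} min(t, r_{A,B}(x)) + w + t(t + α)`, `w = min(α − 1, 1)` (i.e.
`Σ_{i ≤ t} |N_i(A,B)| ≥ t(|A|+|B|−t−α+1+w) − w`). [cite: HamidouneSerra2008, Thm 1] -/
theorem hamidouneSerra2008_thm_1 {α t : ℕ} (A B : Finset G)
    (hα : ∀ (K : AddSubgroup G) (g : G), (∀ k ∈ K, g + k ∈ A + B) → Nat.card K ≤ α)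
    (htA : t ≤ A.card) (htB : t ≤ B.card) :
    t * (A.card + B.card + 1 + min (α - 1) 1) ≤ NS t A B + min (α - 1) 1 + t * (t + α) := by
  rcases le_total B.card A.card with h | h
  · exact (thm1_aux α B.card A B rfl h hα t htB).1
  · have hα' : ∀ (K : AddSubgroup G) (g : G), (∀ k ∈ K, g + k ∈ B + A) → Nat.card K ≤ α :=
      fun K g hg => hα K g fun k hk => by rw [add_comm A B]; exact hg k hk
    have := (thm1_aux α A.card B A rfl h hα' t htA).1
    rwa [NS_comm, add_comm B.card A.card] at this

/-- **[HamidouneSerra2008, Theorem 1, strictness (I)–(II)]**: if `α ≥ 3` and `t ≥ 2`, or `α ≥ 2` and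
`t = 2`, then (1) is strict: `t(|A| + |B| + 2) ≤ Σ_{x ∈ A+B} min(t, r_{A,B}(x)) + t(t + α)` (i.e.
`Σ_{i ≤ t} |N_i(A,B)| ≥ t(|A|+|B|−t−α+2)`). [cite: HamidouneSerra2008, Thm 1] -/
theorem hamidouneSerra2008_thm_1_strict {α t : ℕ} (A B : Finset G)
    (hα : ∀ (K : AddSubgroup G) (g : G), (∀ k ∈ K, g + k ∈ A + B) → Nat.card K ≤ α)
    (htA : t ≤ A.card) (htB : t ≤ B.card) (h : 3 ≤ α ∧ 2 ≤ t ∨ 2 ≤ α ∧ t = 2) :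
    t * (A.card + B.card + 2) ≤ NS t A B + t * (t + α) := by
  rcases h with ⟨hα3, ht2⟩ | ⟨hα2, rfl⟩
  · rcases le_total B.card A.card with h | h
    · exact (thm1_aux α B.card A B rfl h hα t htB).2 hα3 ht2
    · have hα' : ∀ (K : AddSubgroup G) (g : G), (∀ k ∈ K, g + k ∈ B + A) → Nat.card K ≤ α :=
        fun K g hg => hα K g fun k hk => by rw [add_comm A B]; exact hg k hk
      have := (thm1_aux α A.card B A rfl h hα' t htA).2 hα3 ht2
      rwa [NS_comm, add_comm B.card A.card] at this
  · have := two_mul_card_le_NS_two A B hα hα2 htA htB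
    omega

/-- The printed shape of (1) (truncated subtraction in `ℕ`):
`t(|A| + |B| − t − α + 1 + w) ≤ Σ_{i ≤ t} |N_i(A,B)| + w`. [cite: HamidouneSerra2008, Thm 1] -/
theorem hamidouneSerra2008_thm_1_sub {α t : ℕ} (A B : Finset G)
    (hα : ∀ (K : AddSubgroup G) (g : G), (∀ k ∈ K, g + k ∈ A + B) → Nat.card K ≤ α)
    (htA : t ≤ A.card) (htB : t ≤ B.card) :
    t * (A.card + B.card + 1 + min (α - 1) 1 - t - α) ≤ NS t A B + min (α - 1) 1 := by
  have h := hamidouneSerra2008_thm_1 A B hα htA htB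
  by_cases hX : t + α ≤ A.card + B.card + 1 + min (α - 1) 1
  · obtain ⟨m, hm⟩ : ∃ m, A.card + B.card + 1 + min (α - 1) 1 = t + α + m :=
      ⟨A.card + B.card + 1 + min (α - 1) 1 - (t + α), by omega⟩
    rw [hm] at h ⊢
    rw [show t + α + m - t - α = m by omega]
    rw [mul_add] at h
    omega
  · rw [show A.card + B.card + 1 + min (α - 1) 1 - t - α = 0 by omega, mul_zero]
    exact Nat.zero_le _

/-- **The local Pollard inequality** (`α = 1` in Theorem 1): if `A + B` contains no coset of a non-trivial
subgroup, then `Σ_{i ≤ t} |N_i(A,B)| ≥ t(|A| + |B| − t)` for all `t ≤ min(|A|,|B|)`, in every abelian group.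
[cite: HamidouneSerra2008, Thm 1] -/
theorem pollard_of_no_coset {t : ℕ} (A B : Finset G)
    (h1 : ∀ (K : AddSubgroup G) (g : G), (∀ k ∈ K, g + k ∈ A + B) → Nat.card K ≤ 1)
    (htA : t ≤ A.card) (htB : t ≤ B.card) : t * (A.card + B.card - t) ≤ NS t A B := by
  have h := hamidouneSerra2008_thm_1 A B h1 htA htB
  norm_num at h
  by_cases hX : t ≤ A.card + B.card
  · obtain ⟨m, hm⟩ : ∃ m, A.card + B.card = t + m := ⟨A.card + B.card - t, by omega⟩
    rw [hm] at h ⊢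
    rw [Nat.add_sub_cancel_left]
    nlinarith [h]
  · rw [show A.card + B.card - t = 0 by omega, mul_zero]
    exact Nat.zero_le _

end HamidouneSerra

end Literature.Combinatorics.Additive
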